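import Summits.CriticalPhenomena.CardyFormulaZ2.Theorems.CardyBoundaryCoulombGasBoundaryDefectGaussianRStubRealisabilityPart3

/-!
# Stub `stub_realisability` of line `rainbow-monomials-in-excursion-kernels` — Part 4:
# the denominator of the rainbow ratio: `‖Z(ofDomain V)‖ = 2^{|E|} > 0` on hole-free domains
# (crux `BoundaryDefectGaussianR`, stmt-CriticalPhenomena-14132)

Corollaries of the closed-collar dictionary D1 of Part 3 (`Z_ofDomain_eq_two_pow`) in the form
consumed by the registered stub REAL (`0 < ‖Zins‖ / ‖Z‖`) and by the cluster-locality stub: for a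
finite `V ⊂ ℤ²` with king-connected complement, `‖(ofDomain V).Z‖ = 2^{|inducedEdges V|}`, in
particular `Z ≠ 0` and `0 < ‖Z‖`.

Registered sub-goal carried here: `s9_normZOfDomain`.
-/

noncomputable section

namespace Summit.CriticalPhenomena.CardyFormulaZ2.Cruxes.BoundaryDefectGaussianR.RainbowMonomialsInExcursionKernels

open Finset Literature.Probability.LatticeModels Literature.Probability.LatticeModels.CollarLegModel

variable {V : Finset (ℤ × ℤ)}
  (hV : ∀ u ∉ V, ∀ w ∉ V,
    Relation.ReflTransGen (fun b c : ℤ × ℤ => b ∉ V ∧ c ∉ V ∧ max |b.1 - c.1| |b.2 - c.2| ≤ 1) u w)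
include hV

/-- **`‖Z(ofDomain V)‖ = 2^{|E|}`** on a hole-free collar domain. [cite: BaxterKellandWu1976, §3–§4] -/
theorem norm_Z_ofDomain : ‖(ofDomain V).Z‖ = (2 : ℝ) ^ (inducedEdges V).card := by
  rw [Z_ofDomain_eq_two_pow hV, norm_pow]
  norm_num

/-- `Z(ofDomain V) ≠ 0` on a hole-free collar domain. [cite: BaxterKellandWu1976, §3–§4] -/
theorem Z_ofDomain_ne_zero : (ofDomain V).Z ≠ 0 := by
  rw [Z_ofDomain_eq_two_pow hV]
  exact pow_ne_zero _ two_ne_zero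

/-- `0 < ‖Z(ofDomain V)‖` on a hole-free collar domain (the denominator of the rainbow ratio). [cite: BaxterKellandWu1976, §3–§4] -/
theorem norm_Z_ofDomain_pos : 0 < ‖(ofDomain V).Z‖ :=
  norm_pos_iff.2 (Z_ofDomain_ne_zero hV)

omit hV in
/-- **Sub-goal `s9_normZOfDomain`** (registered on stmt-CriticalPhenomena-14132): the denominator of
the rainbow ratio of REAL on a hole-free collar domain, `‖Z(ofDomain V)‖ = 2^{|inducedEdges V|}`
(so `0 < ‖Z‖`). [cite: BaxterKellandWu1976, §3–§4] -/
theorem s9_normZOfDomain : ∀ V : Finset (ℤ × ℤ), (∀ u ∉ V, ∀ w ∉ V, Relation.ReflTransGen (fun b c : ℤ × ℤ => b ∉ V ∧ c ∉ V ∧ max |b.1 - c.1| |b.2 - c.2| ≤ 1) u w) → ‖(Literature.Probability.LatticeModels.CollarLegModel.ofDomain V).Z‖ = (2 : ℝ) ^ (Literature.Probability.LatticeModels.CollarLegModel.inducedEdges V).card :=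
  fun _ hV => norm_Z_ofDomain hV

end Summit.CriticalPhenomena.CardyFormulaZ2.Cruxes.BoundaryDefectGaussianR.RainbowMonomialsInExcursionKernels

end
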